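import Summits.Ventures.PercRepro.RankLevelSetDepCountHeavySq

/-!
# PercRepro — THE DISJOINT PAIR COUNT AND THE SIZE-CAPPED HEAVY COUNT (p8 g4, S3)

`proofs/SUBCLAIM-S3-p8.md` §3p. Two devices that sharpen the heavy / light count of the dependent rank-`q` sets
(`ncard_eRk_eq_ncard_le_le_heavy_sq`, RankLevelSetDepCountHeavySq) with NO new matroid input:

* **THE DISJOINT PAIR COUNT** (`card_pairsF_le_disj`): a pair `(C, B′)` of `pairsF` has `B′ ⊆ E ∖ C` by definition
  (`Disjoint B′ C`), so the pairs with a `k`-circuit number at most `s_k·C(n − k, q + 1 − k)` — in place of night-1's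
  `s_k·C(n, q + 1 − k)` (`card_pairsF_le`). At level `6` the `s₃`-term loses the factor `C(n − 3, 4)/C(n, 4) ≈ 0.74` at
  `n ≈ 42`, the `s₄`-term `C(n − 4, 3)/C(n, 3) ≈ 0.73`.
* **THE SIZE-CAPPED HEAVY COUNT** (`ncard_heavy_le_cap`): the heavy sets that matter have at most `c` elements (`c = d`
  in the `U`-count, `c = min 39 (6 + d)` in the rank-`6` tail count), and a heavy `B` lies in `UG` or in `{x} ∪ UH`
  (`heavy_subset`); so `#{heavy, |B| ≤ c} ≤ Σ_{j ≤ c} C(|UG|, j) + (n + 1)·Σ_{j ≤ c} C(|UH|, j)` in place of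
  `2^{|UG|} + (n + 1)·2^{|UH|}` (`ncard_heavy_le`). At `(33, 12)` (`uG = 24`, `uH = 20`, `c = 12`) this is `52 M`
  against `65 M` heavy sets.
* **`ncard_eRk_eq_ncard_le_le_heavy_sq_cap`**: the count of RankLevelSetDepCountHeavySq with the heavy term restricted
  to the sets of at most `d` elements (the level sums only ever see sets of `q + 1 … d` elements:
  `sum_card_levelHeavy_le_cap`). Axioms: standard.
-/

open scoped Matroid

namespace PercRepro

namespace Matroid

open Set Finset

variable {α : Type} {M : _root_.Matroid α}

open scoped Classical in
/-- **THE DISJOINT PAIR COUNT**: `#pairsF ≤ Σ_k s_k·C(n − k, q + 1 − k)` — the second member `B′` of a pair is a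
`(q + 1 − k)`-subset of `E ∖ C`. -/
theorem card_pairsF_le_disj [M.Finite] (q : ℕ) :
    (pairsF M q).card ≤
      ∑ k ∈ Finset.Icc 3 (q + 1),
        {C | M.IsCircuit C ∧ C.ncard = k}.ncard * (M.E.ncard - k).choose (q + 1 - k) := by
  have hsub : pairsF M q ⊆ (Finset.Icc 3 (q + 1)).biUnion (fun k => (circF M k).biUnion
      (fun C => ({C} : Finset (Set α)) ×ˢ subsF ((groundF M).filter (fun x => x ∉ C)) (q + 1 - k))) := by
    intro p hp
    have hp' := hp
    unfold pairsF at hp'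
    rw [Finset.mem_filter] at hp'
    obtain ⟨hpmem, hdisj, -⟩ := hp'
    rw [Finset.mem_biUnion] at hpmem
    obtain ⟨k, hk, hpk⟩ := hpmem
    rw [Finset.mem_product] at hpk
    obtain ⟨h1, h2⟩ := hpk
    rw [Finset.mem_biUnion]
    refine ⟨k, hk, ?_⟩
    rw [Finset.mem_biUnion]
    refine ⟨p.1, h1, ?_⟩
    rw [Finset.mem_product, Finset.mem_singleton]
    refine ⟨rfl, ?_⟩
    unfold subsF at h2 ⊢
    rw [Finset.mem_image] at h2 ⊢
    obtain ⟨s, hs, hs'⟩ := h2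
    rw [Finset.mem_powersetCard] at hs
    refine ⟨s, ?_, hs'⟩
    rw [Finset.mem_powersetCard]
    refine ⟨?_, hs.2⟩
    intro x hx
    rw [Finset.mem_filter]
    refine ⟨hs.1 hx, ?_⟩
    intro hxC
    have hxp2 : x ∈ p.2 := by rw [← hs']; exact_mod_cast hx
    exact Set.disjoint_left.1 hdisj hxp2 hxC
  refine (Finset.card_le_card hsub).trans ?_
  refine Finset.card_biUnion_le.trans ?_
  apply Finset.sum_le_sum
  intro k _
  refine Finset.card_biUnion_le.trans ?_
  rw [← card_circF]
  calc ∑ C ∈ circF M k,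
        (({C} : Finset (Set α)) ×ˢ subsF ((groundF M).filter (fun x => x ∉ C)) (q + 1 - k)).card
      ≤ ∑ _C ∈ circF M k, (M.E.ncard - k).choose (q + 1 - k) := by
        apply Finset.sum_le_sum
        intro C hC
        rw [Finset.card_product, Finset.card_singleton, one_mul]
        refine (card_subsF_le _ _).trans ?_
        apply Nat.choose_le_choose
        have hCk := mem_circF.1 hC
        have hCE : C ⊆ M.E := hCk.1.subset_ground
        have hCfin : C.Finite := M.ground_finite.subset hCE
        have hfilt : (groundF M).filter (fun x => x ∈ C) = hCfin.toFinset := by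
          ext x
          rw [Finset.mem_filter, Set.Finite.mem_toFinset]
          constructor
          · exact fun h => h.2
          · intro hx
            refine ⟨?_, hx⟩
            rw [← Finset.mem_coe, coe_groundF]
            exact hCE hx
        have hcard : ((groundF M).filter (fun x => x ∈ C)).card = k := by
          rw [hfilt, ← Set.ncard_eq_toFinset_card C hCfin, hCk.2]
        have hadd := Finset.card_filter_add_card_filter_not (s := groundF M) (fun x => x ∈ C)
        rw [hcard, card_groundF] at hadd
        omega
    _ = (circF M k).card * (M.E.ncard - k).choose (q + 1 - k) := by
        rw [Finset.sum_const, smul_eq_mul]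

open scoped Classical in
/-- The level sums of the heavy sets only see sets of at most `d` elements. -/
theorem sum_card_levelHeavy_le_cap [M.Finite] (q ν₁ d : ℕ) :
    ∑ m ∈ Finset.Icc (q + 1) d, (levelHeavy M q ν₁ m).card ≤
      {B : Set α | B ⊆ M.E ∧ M.eRk B = (q : ℕ∞) ∧ q + ν₁ ≤ (M.closure B).ncard ∧ B.ncard ≤ d}.ncard := by
  set T := (Finset.Icc (q + 1) d).biUnion (fun m => levelHeavy M q ν₁ m) with hT
  have hdisj : ∀ m ∈ Finset.Icc (q + 1) d, ∀ m' ∈ Finset.Icc (q + 1) d, m ≠ m' →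
      Disjoint (levelHeavy M q ν₁ m) (levelHeavy M q ν₁ m') := by
    intro m _ m' _ hmm'
    rw [Finset.disjoint_left]
    intro B hB hB'
    unfold levelHeavy at hB hB'
    rw [Finset.mem_filter] at hB hB'
    have h1 := (mem_levelF.1 hB.1).2.1
    have h2 := (mem_levelF.1 hB'.1).2.1
    omega
  rw [← Finset.card_biUnion hdisj, ← hT]
  have hfin : {B : Set α | B ⊆ M.E ∧ M.eRk B = (q : ℕ∞) ∧ q + ν₁ ≤ (M.closure B).ncard ∧ B.ncard ≤ d}.Finite :=
    M.ground_finite.finite_subsets.subset (fun B hB => hB.1)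
  calc T.card = (T.image (fun s : Finset α => (s : Set α))).card :=
        (Finset.card_image_of_injective _ Finset.coe_injective).symm
    _ = ((T.image (fun s : Finset α => (s : Set α)) : Finset (Set α)) : Set (Set α)).ncard :=
        (Set.ncard_coe_finset _).symm
    _ ≤ _ := by
        apply ncard_le_ncard _ hfin
        intro B hB
        rw [Finset.mem_coe, Finset.mem_image] at hB
        obtain ⟨s, hs, rfl⟩ := hB
        rw [hT, Finset.mem_biUnion] at hs
        obtain ⟨m, hm, hsm⟩ := hs
        unfold levelHeavy at hsm
        rw [Finset.mem_filter] at hsm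
        obtain ⟨hsl, hheavy⟩ := hsm
        obtain ⟨hsg, hsm', hsq⟩ := mem_levelF.1 hsl
        refine ⟨?_, hsq, hheavy, ?_⟩
        · rw [← coe_groundF]
          exact_mod_cast hsg
        · rw [Finset.mem_Icc] at hm
          rw [Set.ncard_coe_finset, hsm']
          exact hm.2

/-- **THE SIZE-CAPPED HEAVY COUNT**: the heavy rank-`q` sets with at most `c` elements number at most
`Σ_{j ≤ c} C(|UG|, j) + (n + 1)·Σ_{j ≤ c} C(|UH|, j)`. -/
theorem ncard_heavy_le_cap [M.Finite] (q ν₁ c : ℕ) :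
    {B : Set α | B ⊆ M.E ∧ M.eRk B = (q : ℕ∞) ∧ q + ν₁ ≤ (M.closure B).ncard ∧ B.ncard ≤ c}.ncard ≤
      ∑ j ∈ Finset.range (c + 1), (UG M q ν₁).ncard.choose j +
        (M.E.ncard + 1) * ∑ j ∈ Finset.range (c + 1), (UH M q ν₁).ncard.choose j := by
  classical
  have hUGE := UG_subset_ground (M := M) q ν₁
  have hUHE := UH_subset_ground (M := M) q ν₁
  have hUGfin : (UG M q ν₁).Finite := M.ground_finite.subset hUGE
  have hUHfin : (UH M q ν₁).Finite := M.ground_finite.subset hUHE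
  set T₁ := {B : Set α | B ⊆ (hUGfin.toFinset : Set α) ∧ B.ncard ≤ c} with hT₁def
  set T₂ := {B : Set α | (∃ x ∈ M.E, B ⊆ insert x (UH M q ν₁)) ∧ B.ncard ≤ c} with hT₂def
  have hsub : {B : Set α | B ⊆ M.E ∧ M.eRk B = (q : ℕ∞) ∧ q + ν₁ ≤ (M.closure B).ncard ∧ B.ncard ≤ c} ⊆
      T₁ ∪ T₂ := by
    intro B hB
    rcases heavy_subset hB.1 hB.2.1 hB.2.2.1 with h | h
    · left
      refine ⟨?_, hB.2.2.2⟩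
      rw [Set.Finite.coe_toFinset]
      exact h
    · exact Or.inr ⟨h, hB.2.2.2⟩
  have hT₁fin : T₁.Finite := (Finset.finite_toSet _).finite_subsets.subset (fun B hB => hB.1)
  have hT₂fin : T₂.Finite := by
    apply M.ground_finite.finite_subsets.subset
    intro B hB
    obtain ⟨⟨x, hxE, hBx⟩, -⟩ := hB
    exact hBx.trans (Set.insert_subset hxE hUHE)
  have hT₁ : T₁.ncard ≤ ∑ j ∈ Finset.range (c + 1), (UG M q ν₁).ncard.choose j := by
    have := ncard_subsets_ncard_le hUGfin.toFinset c
    rwa [← Set.ncard_eq_toFinset_card _ hUGfin] at this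
  have hT₂ : T₂.ncard ≤ (M.E.ncard + 1) * ∑ j ∈ Finset.range (c + 1), (UH M q ν₁).ncard.choose j := by
    have hfin : ({X : Set α | X ⊆ M.E ∧ X.ncard ≤ 1} ×ˢ
        {Y : Set α | Y ⊆ (hUHfin.toFinset : Set α) ∧ Y.ncard ≤ c}).Finite :=
      (M.ground_finite.finite_subsets.subset (fun X hX => hX.1)).prod
        ((Finset.finite_toSet _).finite_subsets.subset (fun Y hY => hY.1))
    have hinj : T₂.ncard ≤ ({X : Set α | X ⊆ M.E ∧ X.ncard ≤ 1} ×ˢ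
        {Y : Set α | Y ⊆ (hUHfin.toFinset : Set α) ∧ Y.ncard ≤ c}).ncard := by
      refine Set.ncard_le_ncard_of_injOn (fun B => (B \ UH M q ν₁, B ∩ UH M q ν₁)) ?_ ?_ hfin
      · intro B hB
        obtain ⟨⟨x, hxE, hBx⟩, hBc⟩ := hB
        rw [Set.mem_prod]
        refine ⟨⟨?_, ?_⟩, ⟨?_, ?_⟩⟩
        · intro y hy
          exact (Set.insert_subset hxE hUHE) (hBx hy.1)
        · have hsing : B \ UH M q ν₁ ⊆ {x} := by
            intro y hy
            rcases hBx hy.1 with h | h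
            · exact h
            · exact absurd h hy.2
          exact (Set.ncard_le_ncard hsing (Set.finite_singleton x)).trans (by simp)
        · rw [Set.Finite.coe_toFinset]
          exact Set.inter_subset_right
        · have hBfin : B.Finite := M.ground_finite.subset (hBx.trans (Set.insert_subset hxE hUHE))
          exact (Set.ncard_le_ncard Set.inter_subset_left hBfin).trans hBc
      · intro B _ B' _ h
        simp only [Prod.mk.injEq] at h
        rw [← Set.sdiff_union_inter B (UH M q ν₁), ← Set.sdiff_union_inter B' (UH M q ν₁), h.1, h.2]
    rw [Set.ncard_prod] at hinj
    have h1 : {X : Set α | X ⊆ M.E ∧ X.ncard ≤ 1}.ncard ≤ M.E.ncard + 1 := by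
      have := ncard_subsets_ncard_le (groundF M) 1
      rw [coe_groundF, card_groundF] at this
      simpa [Finset.sum_range_succ, add_comm] using this
    have h2 : {Y : Set α | Y ⊆ (hUHfin.toFinset : Set α) ∧ Y.ncard ≤ c}.ncard ≤
        ∑ j ∈ Finset.range (c + 1), (UH M q ν₁).ncard.choose j := by
      have := ncard_subsets_ncard_le hUHfin.toFinset c
      rwa [← Set.ncard_eq_toFinset_card _ hUHfin] at this
    calc T₂.ncard ≤ _ := hinj
      _ ≤ (M.E.ncard + 1) * ∑ j ∈ Finset.range (c + 1), (UH M q ν₁).ncard.choose j :=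
          Nat.mul_le_mul h1 h2
  calc _ ≤ (T₁ ∪ T₂).ncard := ncard_le_ncard hsub (hT₁fin.union hT₂fin)
    _ ≤ T₁.ncard + T₂.ncard := ncard_union_le _ _
    _ ≤ _ := Nat.add_le_add hT₁ hT₂

open scoped Classical in
/-- **The `U`-count with the heavy / light split, the SQUARE multiplicity and the SIZE-CAPPED heavy term**, in `ℚ`:
`#{B ⊆ E : r(B) = q, |B| ≤ d} ≤ C(n, q) + σ²(min(f′ − q, ν₁ − 2))·#(light small pairs) + σ²(ν₁ − 2)·#(light big pairs)
  + #{heavy sets of ≤ d elements}`, `σ²(a) = Σ_{j ≤ d − q − 1} C(a, j)/(j + 1)²`. -/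
theorem ncard_eRk_eq_ncard_le_le_heavy_sq_cap (M : _root_.Matroid α) [M.Finite] (q f' ν₁ : ℕ) (hq : 1 ≤ q)
    (hcirc : ∀ C, M.IsCircuit C → 3 ≤ C.encard) (d : ℕ) :
    ({B : Set α | B ⊆ M.E ∧ M.eRk B = q ∧ B.ncard ≤ d}.ncard : ℚ) ≤
      (M.E.ncard.choose q : ℚ) +
        (∑ j ∈ Finset.range (d - (q + 1) + 1), ((min (f' - q) (ν₁ - 2)).choose j : ℚ) / ((j + 1) ^ 2)) *
          (((pairsLight M q ν₁).filter (fun p => p ∈ pairsSmall M q f')).card : ℚ) +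
        (∑ j ∈ Finset.range (d - (q + 1) + 1), ((ν₁ - 2).choose j : ℚ) / ((j + 1) ^ 2)) *
          (((pairsLight M q ν₁).filter (fun p => p ∉ pairsSmall M q f')).card : ℚ) +
        ({B : Set α | B ⊆ M.E ∧ M.eRk B = (q : ℕ∞) ∧ q + ν₁ ≤ (M.closure B).ncard ∧ B.ncard ≤ d}.ncard : ℚ) := by
  set Ef := groundF M with hEf
  have hE : (Ef : Set α) = M.E := coe_groundF M
  have hEcard : Ef.card = M.E.ncard := card_groundF M
  set S := {B : Set α | B ⊆ M.E ∧ M.eRk B = q ∧ B.ncard ≤ d} with hS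
  set S₁ := {B : Set α | B ⊆ (Ef : Set α) ∧ B.ncard = q} with hS₁
  set S₂ := {B : Set α | B ⊆ M.E ∧ M.eRk B = q ∧ q < B.ncard ∧ B.ncard ≤ d} with hS₂
  set Hv := {B : Set α | B ⊆ M.E ∧ M.eRk B = (q : ℕ∞) ∧ q + ν₁ ≤ (M.closure B).ncard ∧ B.ncard ≤ d} with hHv
  set Ps := ((pairsLight M q ν₁).filter (fun p => p ∈ pairsSmall M q f')).card with hPs
  set Pb := ((pairsLight M q ν₁).filter (fun p => p ∉ pairsSmall M q f')).card with hPb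
  have hsplit : S ⊆ S₁ ∪ S₂ := by
    intro B hB
    have hBfin : B.Finite := M.ground_finite.subset hB.1
    have hle : q ≤ B.ncard := by
      have := M.eRk_le_encard B
      rw [hB.2.1, ← hBfin.cast_ncard_eq] at this
      exact_mod_cast this
    rcases hle.lt_or_eq with h | h
    · exact Or.inr ⟨hB.1, hB.2.1, h, hB.2.2⟩
    · exact Or.inl ⟨by rw [hE]; exact hB.1, h.symm⟩
  have hS₁fin : S₁.Finite := (Ef.finite_toSet.finite_subsets).subset (fun B hB => hB.1)
  have hS₂fin : S₂.Finite := M.ground_finite.finite_subsets.subset (fun B hB => hB.1)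
  have hS₁ : S₁.ncard = M.E.ncard.choose q := by
    rw [hS₁, ncard_subsets_ncard_eq Ef q, hEcard]
  -- the light levels
  have hlevel : ∀ m ∈ Finset.Icc (q + 1) d, ((levelLight M q ν₁ m).card : ℚ) ≤
      ((Ps : ℚ) * ((min (f' - q) (ν₁ - 2)).choose (m - (q + 1)) : ℚ) +
        (Pb : ℚ) * ((ν₁ - 2).choose (m - (q + 1)) : ℚ)) / (((m - q : ℕ) : ℚ) ^ 2) := by
    intro m hm
    rw [Finset.mem_Icc] at hm
    have hpos : (0 : ℚ) < ((m - q : ℕ) : ℚ) ^ 2 := by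
      have : (0 : ℚ) < ((m - q : ℕ) : ℚ) := by exact_mod_cast (by omega : 0 < m - q)
      positivity
    rw [le_div_iff₀ hpos]
    have h := mul_card_levelLight_le_sq q f' ν₁ hq hcirc m
    have h' : (((m - q) ^ 2 * (levelLight M q ν₁ m).card : ℕ) : ℚ) ≤
        ((Ps * (min (f' - q) (ν₁ - 2)).choose (m - (q + 1)) + Pb * (ν₁ - 2).choose (m - (q + 1)) : ℕ) : ℚ) := by
      exact_mod_cast h
    push_cast at h'
    linarith
  -- the levels
  have hS₂q : (S₂.ncard : ℚ) ≤ ∑ m ∈ Finset.Icc (q + 1) d,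
      ((Ps : ℚ) * ((min (f' - q) (ν₁ - 2)).choose (m - (q + 1)) : ℚ) +
        (Pb : ℚ) * ((ν₁ - 2).choose (m - (q + 1)) : ℚ)) / (((m - q : ℕ) : ℚ) ^ 2) + (Hv.ncard : ℚ) := by
    have h3' : ∑ m ∈ Finset.Icc (q + 1) d, (levelHeavy M q ν₁ m).card ≤ Hv.ncard := by
      rw [hHv]
      exact sum_card_levelHeavy_le_cap q ν₁ d
    have h3q : ((∑ m ∈ Finset.Icc (q + 1) d, (levelHeavy M q ν₁ m).card : ℕ) : ℚ) ≤ (Hv.ncard : ℚ) := by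
      exact_mod_cast h3'
    have h2 : ∑ m ∈ Finset.Icc (q + 1) d, (levelF M q m).card =
        ∑ m ∈ Finset.Icc (q + 1) d, (levelLight M q ν₁ m).card +
          ∑ m ∈ Finset.Icc (q + 1) d, (levelHeavy M q ν₁ m).card := by
      rw [← Finset.sum_add_distrib]
      exact Finset.sum_congr rfl (fun m _ => card_levelF_eq_light_add_heavy q ν₁ m)
    calc (S₂.ncard : ℚ) ≤ ((∑ m ∈ Finset.Icc (q + 1) d, (levelF M q m).card : ℕ) : ℚ) := by
          exact_mod_cast ncard_dep_le_sum_levelF q d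
      _ = ∑ m ∈ Finset.Icc (q + 1) d, ((levelLight M q ν₁ m).card : ℚ) +
            ((∑ m ∈ Finset.Icc (q + 1) d, (levelHeavy M q ν₁ m).card : ℕ) : ℚ) := by
          rw [h2]
          push_cast
          rfl
      _ ≤ _ := add_le_add (Finset.sum_le_sum hlevel) h3q
  -- re-index the level sums
  have hre : ∑ m ∈ Finset.Icc (q + 1) d,
      ((Ps : ℚ) * ((min (f' - q) (ν₁ - 2)).choose (m - (q + 1)) : ℚ) +
        (Pb : ℚ) * ((ν₁ - 2).choose (m - (q + 1)) : ℚ)) / (((m - q : ℕ) : ℚ) ^ 2) =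
      ∑ j ∈ Finset.range (d - q),
        ((Ps : ℚ) * ((min (f' - q) (ν₁ - 2)).choose j : ℚ) / (((j : ℚ) + 1) ^ 2) +
          (Pb : ℚ) * ((ν₁ - 2).choose j : ℚ) / (((j : ℚ) + 1) ^ 2)) := by
    rw [show Finset.Icc (q + 1) d = Finset.image (fun j => q + 1 + j) (Finset.range (d - q)) from ?_]
    · rw [Finset.sum_image (fun a _ b _ h => by omega)]
      apply Finset.sum_congr rfl
      intro j _
      rw [show q + 1 + j - (q + 1) = j by omega, show q + 1 + j - q = j + 1 by omega]
      push_cast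
      ring
    · ext m
      rw [Finset.mem_Icc, Finset.mem_image]
      constructor
      · intro hm
        exact ⟨m - (q + 1), by rw [Finset.mem_range]; omega, by omega⟩
      · rintro ⟨j, hj, rfl⟩
        rw [Finset.mem_range] at hj
        omega
  have hrange : Finset.range (d - q) ⊆ Finset.range (d - (q + 1) + 1) := Finset.range_mono (by omega)
  have hS₂q' : (S₂.ncard : ℚ) ≤
      (∑ j ∈ Finset.range (d - (q + 1) + 1), ((min (f' - q) (ν₁ - 2)).choose j : ℚ) / ((j + 1) ^ 2)) * (Ps : ℚ) +
        (∑ j ∈ Finset.range (d - (q + 1) + 1), ((ν₁ - 2).choose j : ℚ) / ((j + 1) ^ 2)) * (Pb : ℚ) +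
        (Hv.ncard : ℚ) := by
    rw [Finset.sum_mul, Finset.sum_mul]
    refine hS₂q.trans (add_le_add (hre.le.trans ?_) (le_refl _))
    rw [Finset.sum_add_distrib]
    apply add_le_add
    · refine (Finset.sum_le_sum_of_subset_of_nonneg hrange (fun j _ _ => by positivity)).trans' ?_
      apply le_of_eq
      apply Finset.sum_congr rfl
      intro j _
      ring
    · refine (Finset.sum_le_sum_of_subset_of_nonneg hrange (fun j _ _ => by positivity)).trans' ?_
      apply le_of_eq
      apply Finset.sum_congr rfl
      intro j _
      ring
  have hSq : (S.ncard : ℚ) ≤ (S₁.ncard : ℚ) + (S₂.ncard : ℚ) := by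
    have : S.ncard ≤ S₁.ncard + S₂.ncard :=
      (ncard_le_ncard hsplit (hS₁fin.union hS₂fin)).trans (ncard_union_le _ _)
    exact_mod_cast this
  rw [hS₁] at hSq
  linarith

end Matroid

end PercRepro
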